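import Summits.BirchSwinnertonDyer.Rank1Residual.Additive.GordHigherCongruentPairGVShift
import Summits.BirchSwinnertonDyer.Rank1Residual.Additive.GordKummerIdentificationHigher
import Summits.BirchSwinnertonDyer.Rank1Residual.Additive.TorsionOrderOfTorsionIso
import HarnessLib

/-!
# `CongruentLambdaShift` and the `μ = 0` transfer on Gord × Gord links of ANY defects with EVERY
# per-curve binder fed by RECORDS: the R-D identifications by cc-typer-2's S2 (p05's T-RD-E346 K5),
# the transfer by the GV §2 record — `p ≥ 5`, off the swap locus
# (cell `b2b-bsdres`, team n1011, seat p07 (gen 7); row T-ROL-EXP FILE F; sequel of FILE D2 after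
# p05's K5 `GordKummerIdentificationHigher` landed)

HONEST FRAMING (cell `b2b-bsdres`, run/shared/lean/b2b/bsd-rank1-residual/, verbatim in every
file): the goal of the cell is to DELETE the COMBINATION-SHAPED residual classes of the
Birch–Swinnerton-Dyer formula for ALL analytic-rank `≤ 1` elliptic curves over `ℚ` — "full BSD
formula for every rank `≤ 1` curve in class `C`" assembled STRICTLY from published theorems — so
that the rank-`≤ 1` remainder becomes exactly the CONSTRUCTION-SHAPED classes, which are TYPED
(missing-input `Prop`s), NOT attempted. This is not "finishing BSD". Team n1011 (N10/N11, (G-ord)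
rows of every defect): research route; labels and marks UNCHANGED; nothing booked. TOOL theorems only:
NO definition, NO named fact. CONDITIONAL on the tree's EXISTING records: `hGV` = A240 (now DERIVED
in the kernel from T-GV23L `h23` + A234 `h414`: p12's
`muLambdaAlg_transfer_of_torsionIso_potOrd_of_not_dvd_torsionOrder_of_records`, pass that term for
`hGV`), `hS2` = cc-typer-2's S2 `Greenberg1999.imKummer_ge_strictCondition_goodOrdinaryModel` (LNM 1716
§2 Prop. 2.4 for a good ordinary MODEL; A239 is DERIVED from it).

## What and why

FILE D2 (`GordHigherCongruentPairGVShift`) typed Route G's input `CongruentLambdaShift` and GV's `μ`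
transfer on links with a (G-ord) member of any defect, keeping the R-D identification
`RamifiedLineKummerEqAt W p` of an `e ∈ {3,4,6}` member as a binder. p05's T-RD-E346 K5
(`GordKummerIdentificationHigher`, p05 GEN 6) proves it mod S2 on every (G-ord) row at `p ≥ 5`
(`GoodModelLine.ramifiedLineKummerEqAt_of_typeGOrd_of_semistabilityIndex_ne_two`, and A239 ⇐ S2 for
`e = 2`). This file feeds the binder: on a Gord × Gord link of ANY defects off the swap locus the ONLY
hypotheses left are the two records (`hGV`, `hS2`), the class data, a `TorsionIso` certificate, `Σ₀`,
and on X3 one census torsion bit — exactly the binder list of the defect-2 theorems of record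
(cc-typer-2's `ClassX4Gord.congruentLambdaShift_of_gv_of_grK_of_torsionIso`), now for every `e`.

* §0 `ramifiedLineKummerEqAt_of_s2_of_typeGOrd` — R-D on EVERY (G-ord) row at `p ≥ 5` mod S2 (K5 for
  `e ≠ 2`, A239 ⇐ S2 + `ramifiedLineKummerEqAt_of_typeGOrd` for `e = 2`).
* §1 `congruentLambdaShift_of_gv_of_s2_of_typeGOrd_typeGOrd_of_not_dvd_lcm`, `mu_eq_zero_…`, and the
  class forms `ClassX4Gord./ClassX3Gord.congruentLambdaShift_of_gv_of_s2_of_not_dvd_lcm`,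
  `….mu_eq_zero_of_gv_of_s2_of_not_dvd_lcm`.

NOT here: budgets / ENDs (FILE E / construction-shaped); the swap locus; `p = 3`.

References: R. Greenberg, V. Vatsal, Invent. Math. 142 (2000) §2 Prop. (2.8), Remark (2.9), Cor. (2.3),
Prop. (2.4), pp. 26–27 [GreenbergVatsal2000]; R. Greenberg, LNM 1716 (1999) §2 Prop. 2.4
[GreenbergLNM1716]; cells/n1011/skel/T-ROL-EXP.md (67779f27699eb635), skel/T-RD-E346.md
(f88cc66b311ca16d).
-/

set_option autoImplicit false

noncomputable section

open scoped Classical NumberField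

open NumberField IsDedekindDomain Field WeierstrassCurve
  Literature.NumberTheory.GaloisRepresentations
  Literature.NumberTheory.EllipticCurves
  Literature.NumberTheory.EllipticCurves.Rank1Residual
  Literature.NumberTheory.EllipticCurves.GreenbergSelmer
  Literature.NumberTheory.EllipticCurves.Greenberg1999
  Literature.NumberTheory.EllipticCurves.GreenbergVatsal2000
  Literature.NumberTheory.EllipticCurves.EmertonPollackWeston2006
  Summit.BirchSwinnertonDyer.Rank1Residual.X1.CongruenceTransfer

namespace Summit.BirchSwinnertonDyer.Rank1Residual.Additive

namespace GordHigherCongruentPairGVOfS2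

open GordHigherCongruentPairGVShift

variable {p : ℕ} [hp : Fact p.Prime] {W W₁ W₂ : WeierstrassCurve ℚ} [W.IsElliptic] [W.IsGloballyMinimal]
  [W₁.IsElliptic] [W₁.IsGloballyMinimal] [W₂.IsElliptic] [W₂.IsGloballyMinimal]

/-! ### §0 The R-D identification on EVERY (G-ord) row at `p ≥ 5`, mod S2 -/

/-- **`RamifiedLineKummerEqAt W p` on every (G-ord) row at `p ≥ 5`, every defect, mod S2 only**:
`e ≠ 2` by p05's K5 `GoodModelLine.ramifiedLineKummerEqAt_of_typeGOrd_of_semistabilityIndex_ne_two`,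
`e = 2` by p07-g5's `AdditivePotMult.ramifiedLineKummerEqAt_of_typeGOrd` with A239 derived from S2
(`imKummer_ge_strictCondition_goodOrdinary_of_goodOrdinaryModel`). Class-free binders.
[cite: GreenbergLNM1716, §2 Prop. 2.4 (p. 80)] -/
theorem ramifiedLineKummerEqAt_of_s2_of_typeGOrd (hS2 : imKummer_ge_strictCondition_goodOrdinaryModel)
    (hp5 : 5 ≤ p) (hG : TypeGOrd W p) (hadd : Addv W p) : RamifiedLineKummerEqAt W p := by
  by_cases he : semistabilityIndex W p = 2
  · exact AdditivePotMult.ramifiedLineKummerEqAt_of_typeGOrd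
      (imKummer_ge_strictCondition_goodOrdinary_of_goodOrdinaryModel hS2) (by omega) hG hadd he
  · exact GoodModelLine.ramifiedLineKummerEqAt_of_typeGOrd_of_semistabilityIndex_ne_two W p hS2 hp5 hG
      hadd he

/-! ### §1 `CongruentLambdaShift` and `μ` on Gord × Gord links, all per-curve binders from records -/

/-- **Route G's typed input on a Gord × Gord link of ANY defects, EVERY per-curve binder from
records** (`p ≥ 5`, `(p−1) ∤ lcm(e₁,e₂)`): `CongruentLambdaShift W₁ W₂ p (Σ_{w∈Σ₀}(δ(E₂,w) − δ(E₁,w)))`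
from `hGV` (A240, = `…_of_records h23 h414`), `hS2` (S2), `TypeGOrd ∧ Addv` on both, the torsion bits,
a `TorsionIso` certificate and `Σ₀`. (FILE D2 with `hRD_i := ramifiedLineKummerEqAt_of_s2_of_typeGOrd`.)
[cite: GreenbergVatsal2000, §2 Prop. (2.8) with Remark (2.9), Cor. (2.3), Prop. (2.4), pp. 26–27 (arXiv:math/9906215)]
[cite: GreenbergLNM1716, §2 Prop. 2.4 (p. 80)] -/
theorem congruentLambdaShift_of_gv_of_s2_of_typeGOrd_typeGOrd_of_not_dvd_lcm
    (hGV : muLambdaAlg_transfer_of_torsionIso_potOrd_of_not_dvd_torsionOrder)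
    (hS2 : imKummer_ge_strictCondition_goodOrdinaryModel) (hp5 : 5 ≤ p)
    (hG₁ : TypeGOrd W₁ p) (hadd₁ : Addv W₁ p) (hG₂ : TypeGOrd W₂ p) (hadd₂ : Addv W₂ p)
    (hlcm : ¬ (p - 1) ∣ Nat.lcm (semistabilityIndex W₁ p) (semistabilityIndex W₂ p))
    (htors₁ : ¬ p ∣ W₁.torsionOrder) (htors₂ : ¬ p ∣ W₂.torsionOrder) (hT : TorsionIso W₁ W₂ p)
    (S₀ : Finset (HeightOneSpectrum (𝓞 ℚ))) (hS₀ : ∀ w ∈ S₀, ((p : ℕ) : 𝓞 ℚ) ∉ w.asIdeal)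
    (hS₁ : ∀ w : HeightOneSpectrum (𝓞 ℚ), w ∉ S₀ → ((p : ℕ) : 𝓞 ℚ) ∉ w.asIdeal →
      W₁.HasGoodReductionAt w)
    (hS₂ : ∀ w : HeightOneSpectrum (𝓞 ℚ), w ∉ S₀ → ((p : ℕ) : 𝓞 ℚ) ∉ w.asIdeal →
      W₂.HasGoodReductionAt w) :
    CongruentLambdaShift W₁ W₂ p (∑ w ∈ S₀, ((delta W₂ p w : ℤ) - (delta W₁ p w : ℤ))) :=
  congruentLambdaShift_of_gv_of_typeGOrd_typeGOrd_of_not_dvd_lcm hGV hp5 hG₁ hadd₁ hG₂ hadd₂ hlcm htors₁ htors₂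
    (ramifiedLineKummerEqAt_of_s2_of_typeGOrd hS2 hp5 hG₁ hadd₁)
    (ramifiedLineKummerEqAt_of_s2_of_typeGOrd hS2 hp5 hG₂ hadd₂) hT S₀ hS₀ hS₁ hS₂

/-- **GV's `μ = 0` transfer on a Gord × Gord link of ANY defects, every per-curve binder from
records** (cyclotomic data, torsion duals). [cite: GreenbergVatsal2000, §2 Prop. (2.8) with Remark (2.9), Cor. (2.3), pp. 26–27 (arXiv:math/9906215)]
[cite: GreenbergLNM1716, §2 Prop. 2.4 (p. 80)] -/
theorem mu_eq_zero_of_gv_of_s2_of_typeGOrd_typeGOrd_of_not_dvd_lcm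
    (hGV : muLambdaAlg_transfer_of_torsionIso_potOrd_of_not_dvd_torsionOrder)
    (hS2 : imKummer_ge_strictCondition_goodOrdinaryModel) (hp5 : 5 ≤ p)
    (hG₁ : TypeGOrd W₁ p) (hadd₁ : Addv W₁ p) (hG₂ : TypeGOrd W₂ p) (hadd₂ : Addv W₂ p)
    (hlcm : ¬ (p - 1) ∣ Nat.lcm (semistabilityIndex W₁ p) (semistabilityIndex W₂ p))
    (htors₁ : ¬ p ∣ W₁.torsionOrder) (htors₂ : ¬ p ∣ W₂.torsionOrder) (hT : TorsionIso W₁ W₂ p)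
    (S₀ : Finset (HeightOneSpectrum (𝓞 ℚ))) (hS₀ : ∀ w ∈ S₀, ((p : ℕ) : 𝓞 ℚ) ∉ w.asIdeal)
    (hS₁ : ∀ w : HeightOneSpectrum (𝓞 ℚ), w ∉ S₀ → ((p : ℕ) : 𝓞 ℚ) ∉ w.asIdeal →
      W₁.HasGoodReductionAt w)
    (hS₂ : ∀ w : HeightOneSpectrum (𝓞 ℚ), w ∉ S₀ → ((p : ℕ) : 𝓞 ℚ) ∉ w.asIdeal →
      W₂.HasGoodReductionAt w)
    {κ : ZpExtension ℚ p} {γ : absoluteGaloisGroup ℚ} (hκ : κ.IsCyclotomic)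
    (hγ : κ.IsTopGenerator γ) (hγ' : IsCyclotomicVariable p γ)
    (D₁ : W₁.SelmerDualData κ γ) (D₂ : W₂.SelmerDualData κ γ)
    [Module.Finite (IwasawaAlgebra p) D₁.X] [Module.Finite (IwasawaAlgebra p) D₂.X]
    (hX₁ : D₁.IsTorsion) (hX₂ : D₂.IsTorsion) (hμ₁ : D₁.mu = 0) : D₂.mu = 0 :=
  mu_eq_zero_of_gv_of_typeGOrd_typeGOrd_of_not_dvd_lcm hGV hp5 hG₁ hadd₁ hG₂ hadd₂ hlcm htors₁ htors₂
    (ramifiedLineKummerEqAt_of_s2_of_typeGOrd hS2 hp5 hG₁ hadd₁)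
    (ramifiedLineKummerEqAt_of_s2_of_typeGOrd hS2 hp5 hG₂ hadd₂) hT S₀ hS₀ hS₁ hS₂ hκ hγ hγ' D₁ D₂ hX₁ hX₂ hμ₁

end GordHigherCongruentPairGVOfS2

open GordHigherCongruentPairGVOfS2

variable {p : ℕ} [hp : Fact p.Prime] {W₁ W₂ : WeierstrassCurve ℚ} [W₁.IsElliptic] [W₁.IsGloballyMinimal]
  [W₂.IsElliptic] [W₂.IsGloballyMinimal]

/-- **X4♯(G-ord) × X4♯(G-ord), ANY defects, `p ≥ 5`, off the swap locus: `CongruentLambdaShift` from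
the GV record + S2 + `TorsionIso` + `Σ₀` — NO line, NO R-D, NO image, NO defect binder** (torsion bits
by irreducibility). The every-defect form of cc-typer-2's
`ClassX4Gord.congruentLambdaShift_of_gv_of_grK_of_torsionIso`. X4♯(G-ord) stays CONSTRUCTION-SHAPED;
nothing booked. [cite: GreenbergVatsal2000, §2 Prop. (2.8) with Remark (2.9), Cor. (2.3), Prop. (2.4), pp. 26–27 (arXiv:math/9906215)]
[cite: GreenbergLNM1716, §2 Prop. 2.4 (p. 80)] [cite: Mazur1977, Ch. III §5, p. 157] -/
theorem ClassX4Gord.congruentLambdaShift_of_gv_of_s2_of_not_dvd_lcm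
    (hGV : muLambdaAlg_transfer_of_torsionIso_potOrd_of_not_dvd_torsionOrder)
    (hS2 : imKummer_ge_strictCondition_goodOrdinaryModel) (hp5 : 5 ≤ p)
    (hX₁ : ClassX4Gord W₁ p) (hX₂ : ClassX4Gord W₂ p)
    (hlcm : ¬ (p - 1) ∣ Nat.lcm (semistabilityIndex W₁ p) (semistabilityIndex W₂ p))
    (hT : TorsionIso W₁ W₂ p)
    (S₀ : Finset (HeightOneSpectrum (𝓞 ℚ))) (hS₀ : ∀ w ∈ S₀, ((p : ℕ) : 𝓞 ℚ) ∉ w.asIdeal)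
    (hS₁ : ∀ w : HeightOneSpectrum (𝓞 ℚ), w ∉ S₀ → ((p : ℕ) : 𝓞 ℚ) ∉ w.asIdeal →
      W₁.HasGoodReductionAt w)
    (hS₂ : ∀ w : HeightOneSpectrum (𝓞 ℚ), w ∉ S₀ → ((p : ℕ) : 𝓞 ℚ) ∉ w.asIdeal →
      W₂.HasGoodReductionAt w) :
    CongruentLambdaShift W₁ W₂ p (∑ w ∈ S₀, ((delta W₂ p w : ℤ) - (delta W₁ p w : ℤ))) :=
  congruentLambdaShift_of_gv_of_s2_of_typeGOrd_typeGOrd_of_not_dvd_lcm hGV hS2 hp5 hX₁.typeGOrd hX₁.addv.2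
    hX₂.typeGOrd hX₂.addv.2 hlcm hX₁.not_dvd_torsionOrder hX₂.not_dvd_torsionOrder hT S₀ hS₀ hS₁ hS₂

/-- **X4♯(G-ord) × X4♯(G-ord), ANY defects, `p ≥ 5`, off the swap locus: `μ(X(E₁)) = 0 ⟹ μ(X(E₂)) = 0`
from the GV record + S2 + `TorsionIso` + `Σ₀`.** Nothing booked.
[cite: GreenbergVatsal2000, §2 Prop. (2.8) with Remark (2.9), Cor. (2.3), pp. 26–27 (arXiv:math/9906215)] -/
theorem ClassX4Gord.mu_eq_zero_of_gv_of_s2_of_not_dvd_lcm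
    (hGV : muLambdaAlg_transfer_of_torsionIso_potOrd_of_not_dvd_torsionOrder)
    (hS2 : imKummer_ge_strictCondition_goodOrdinaryModel) (hp5 : 5 ≤ p)
    (hX₁ : ClassX4Gord W₁ p) (hX₂ : ClassX4Gord W₂ p)
    (hlcm : ¬ (p - 1) ∣ Nat.lcm (semistabilityIndex W₁ p) (semistabilityIndex W₂ p))
    (hT : TorsionIso W₁ W₂ p)
    (S₀ : Finset (HeightOneSpectrum (𝓞 ℚ))) (hS₀ : ∀ w ∈ S₀, ((p : ℕ) : 𝓞 ℚ) ∉ w.asIdeal)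
    (hS₁ : ∀ w : HeightOneSpectrum (𝓞 ℚ), w ∉ S₀ → ((p : ℕ) : 𝓞 ℚ) ∉ w.asIdeal →
      W₁.HasGoodReductionAt w)
    (hS₂ : ∀ w : HeightOneSpectrum (𝓞 ℚ), w ∉ S₀ → ((p : ℕ) : 𝓞 ℚ) ∉ w.asIdeal →
      W₂.HasGoodReductionAt w)
    {κ : ZpExtension ℚ p} {γ : absoluteGaloisGroup ℚ} (hκ : κ.IsCyclotomic)
    (hγ : κ.IsTopGenerator γ) (hγ' : IsCyclotomicVariable p γ)
    (D₁ : W₁.SelmerDualData κ γ) (D₂ : W₂.SelmerDualData κ γ)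
    [Module.Finite (IwasawaAlgebra p) D₁.X] [Module.Finite (IwasawaAlgebra p) D₂.X]
    (hX₁t : D₁.IsTorsion) (hX₂t : D₂.IsTorsion) (hμ₁ : D₁.mu = 0) : D₂.mu = 0 :=
  mu_eq_zero_of_gv_of_s2_of_typeGOrd_typeGOrd_of_not_dvd_lcm hGV hS2 hp5 hX₁.typeGOrd hX₁.addv.2 hX₂.typeGOrd
    hX₂.addv.2 hlcm hX₁.not_dvd_torsionOrder hX₂.not_dvd_torsionOrder hT S₀ hS₀ hS₁ hS₂ hκ hγ hγ' D₁ D₂ hX₁t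
    hX₂t hμ₁

/-- **X3♯(G-ord) × X3♯(G-ord), ANY defects, `p ≥ 5`, off the swap locus: `CongruentLambdaShift` from the
GV record + S2 + `TorsionIso` + `Σ₀` + ONE census bit `p ∤ #E₁(ℚ)_tors`** (the partner's follows:
`not_dvd_torsionOrder_of_torsionIso`). X3♯(G-ord) stays CONSTRUCTION-SHAPED; nothing booked.
[cite: GreenbergVatsal2000, §2 Prop. (2.8) with Remark (2.9), Cor. (2.3), Prop. (2.4), pp. 26–27 (arXiv:math/9906215)]
[cite: GreenbergLNM1716, §2 Prop. 2.4 and Prop. 4.14] -/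
theorem ClassX3Gord.congruentLambdaShift_of_gv_of_s2_of_not_dvd_lcm
    (hGV : muLambdaAlg_transfer_of_torsionIso_potOrd_of_not_dvd_torsionOrder)
    (hS2 : imKummer_ge_strictCondition_goodOrdinaryModel) (hp5 : 5 ≤ p)
    (hX₁ : ClassX3Gord W₁ p) (hX₂ : ClassX3Gord W₂ p)
    (hlcm : ¬ (p - 1) ∣ Nat.lcm (semistabilityIndex W₁ p) (semistabilityIndex W₂ p))
    (htors₁ : ¬ p ∣ W₁.torsionOrder) (hT : TorsionIso W₁ W₂ p)
    (S₀ : Finset (HeightOneSpectrum (𝓞 ℚ))) (hS₀ : ∀ w ∈ S₀, ((p : ℕ) : 𝓞 ℚ) ∉ w.asIdeal)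
    (hS₁ : ∀ w : HeightOneSpectrum (𝓞 ℚ), w ∉ S₀ → ((p : ℕ) : 𝓞 ℚ) ∉ w.asIdeal →
      W₁.HasGoodReductionAt w)
    (hS₂ : ∀ w : HeightOneSpectrum (𝓞 ℚ), w ∉ S₀ → ((p : ℕ) : 𝓞 ℚ) ∉ w.asIdeal →
      W₂.HasGoodReductionAt w) :
    CongruentLambdaShift W₁ W₂ p (∑ w ∈ S₀, ((delta W₂ p w : ℤ) - (delta W₁ p w : ℤ))) :=
  congruentLambdaShift_of_gv_of_s2_of_typeGOrd_typeGOrd_of_not_dvd_lcm hGV hS2 hp5 hX₁.typeGOrd hX₁.addv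
    hX₂.typeGOrd hX₂.addv hlcm htors₁ (not_dvd_torsionOrder_of_torsionIso hT htors₁) hT S₀ hS₀ hS₁ hS₂

/-- **X3♯(G-ord) × X3♯(G-ord), ANY defects, `p ≥ 5`, off the swap locus: `μ(X(E₁)) = 0 ⟹ μ(X(E₂)) = 0`
from the GV record + S2 + `TorsionIso` + `Σ₀` + one census torsion bit.** Nothing booked.
[cite: GreenbergVatsal2000, §2 Prop. (2.8) with Remark (2.9), Cor. (2.3), pp. 26–27 (arXiv:math/9906215)] -/
theorem ClassX3Gord.mu_eq_zero_of_gv_of_s2_of_not_dvd_lcm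
    (hGV : muLambdaAlg_transfer_of_torsionIso_potOrd_of_not_dvd_torsionOrder)
    (hS2 : imKummer_ge_strictCondition_goodOrdinaryModel) (hp5 : 5 ≤ p)
    (hX₁ : ClassX3Gord W₁ p) (hX₂ : ClassX3Gord W₂ p)
    (hlcm : ¬ (p - 1) ∣ Nat.lcm (semistabilityIndex W₁ p) (semistabilityIndex W₂ p))
    (htors₁ : ¬ p ∣ W₁.torsionOrder) (hT : TorsionIso W₁ W₂ p)
    (S₀ : Finset (HeightOneSpectrum (𝓞 ℚ))) (hS₀ : ∀ w ∈ S₀, ((p : ℕ) : 𝓞 ℚ) ∉ w.asIdeal)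
    (hS₁ : ∀ w : HeightOneSpectrum (𝓞 ℚ), w ∉ S₀ → ((p : ℕ) : 𝓞 ℚ) ∉ w.asIdeal →
      W₁.HasGoodReductionAt w)
    (hS₂ : ∀ w : HeightOneSpectrum (𝓞 ℚ), w ∉ S₀ → ((p : ℕ) : 𝓞 ℚ) ∉ w.asIdeal →
      W₂.HasGoodReductionAt w)
    {κ : ZpExtension ℚ p} {γ : absoluteGaloisGroup ℚ} (hκ : κ.IsCyclotomic)
    (hγ : κ.IsTopGenerator γ) (hγ' : IsCyclotomicVariable p γ)
    (D₁ : W₁.SelmerDualData κ γ) (D₂ : W₂.SelmerDualData κ γ)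
    [Module.Finite (IwasawaAlgebra p) D₁.X] [Module.Finite (IwasawaAlgebra p) D₂.X]
    (hX₁t : D₁.IsTorsion) (hX₂t : D₂.IsTorsion) (hμ₁ : D₁.mu = 0) : D₂.mu = 0 :=
  mu_eq_zero_of_gv_of_s2_of_typeGOrd_typeGOrd_of_not_dvd_lcm hGV hS2 hp5 hX₁.typeGOrd hX₁.addv hX₂.typeGOrd
    hX₂.addv hlcm htors₁ (not_dvd_torsionOrder_of_torsionIso hT htors₁) hT S₀ hS₀ hS₁ hS₂ hκ hγ hγ' D₁ D₂
    hX₁t hX₂t hμ₁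

end Summit.BirchSwinnertonDyer.Rank1Residual.Additive

end
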